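import Summits.NavierStokesRegularity.NavierStokesRegularity.Theorems.SwirlHolderTowerAlgebraicFunnelSharp
import HarnessLib

/-!
# SwirlHolderTower, part 4d — the unconditional linear ceiling at EVERY large gauge:
# `γ(N) ≤ 8/(N - 16)` for `N ≥ 20` (seat nsreg-p4)

Support file for the DORMANT route `SwirlThreshold` (crux stmt-NavierStokesRegularity-2002).
Part 4c proved `γ(N_j) ≤ 2/(2j+3)` along the gauges `N_j = 4(2j+2)(2j+5)/(2j+3)` of the
algebraic funnel family.  Since a pair of gauge `N_j` is a pair of every larger gauge
(`IsSteadyPassiveSwirl.mono`), the bound holds at every `N ≥ N_j`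
(`linearHolderLaw_exponent_le_of_ge`); choosing `j = ⌊(N-20)/8⌋` gives the clean statement
`linearHolderLaw_exponent_le_eight_div`: **every Hölder law valid for all steady passive swirl
pairs has `γ(N) ≤ 8/(N-16)` for all `N ≥ 20`** — kernel-only, no `FunnelExponent`, no numerics.
WHAT THIS IS NOT: not NS regularity — a ceiling on LINEAR (passive-scalar) methods from explicit
steady drifts; hard cores untouched; no crux claim.
-/

namespace Summit.NavierStokesRegularity.NavierStokesRegularity.Theorems.SwirlHolderTower

open Set Filter Topology Metric
open scoped Laplacian RealInnerProductSpace
open Literature.Analysis Literature.Analysis.FluidPDE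

noncomputable section

/-! ### Appendix — the ceiling at EVERY large gauge: `γ(N) ≤ 8/(N-16)` for `N ≥ 20` -/

/-- A steady passive swirl pair of gauge `N` is one of every larger gauge. -/
theorem IsSteadyPassiveSwirl.mono {N N' : ℝ}
    {b : EuclideanSpace ℝ (Fin 3) → EuclideanSpace ℝ (Fin 3)} {Θ : EuclideanSpace ℝ (Fin 3) → ℝ}
    (h : IsSteadyPassiveSwirl N b Θ) (hle : N ≤ N') : IsSteadyPassiveSwirl N' b Θ :=
  ⟨fun x hx => (h.1 x hx).trans (div_le_div_of_nonneg_right hle (norm_nonneg x)), h.2⟩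

/-- The ceiling `γ(N) ≤ 2/(2j+3)` holds at every gauge `N ≥ N_j = 4(2j+2)(2j+5)/(2j+3)`. -/
theorem linearHolderLaw_exponent_le_of_ge {γ : ℝ → ℝ} (hlaw : LinearHolderLaw γ) (j : ℕ) {N : ℝ}
    (hN : 4 * ((2 * j + 2) * (2 * j + 5) / (2 * j + 3)) ≤ N) : γ N ≤ 2 / (2 * j + 3) := by
  obtain ⟨L, hLs, hode, hbd, hodd⟩ := exists_odeProfile j
  set m : ℝ := 2 * j + 3 with hm
  have hj0 : (0:ℝ) ≤ j := Nat.cast_nonneg j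
  have hm3 : 3 ≤ m := by rw [hm]; linarith
  have hode' : ∀ t : ℝ, (1 - t ^ 2) * deriv L t + (m - 2) * t * L t = 1 := by
    intro t; rw [hm]; have := hode t; linear_combination this
  have hpair := isSteadyPassiveSwirl_family_sharp hm3 (hLs 2) hode' hbd hodd
  have hN' : 4 * ((m - 1) * (m + 2) / m) = 4 * ((2 * j + 2) * (2 * j + 5) / (2 * j + 3)) := by
    rw [hm]; ring
  have hgm : 2 / m = 2 / (2 * j + 3) := by rw [hm]
  rw [hN', hgm] at hpair
  have hN0 : 0 ≤ N := le_trans (by positivity) hN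
  exact linearHolderLaw_exponent_le_of_pair hlaw hN0 (by positivity) (hpair.mono hN)

/-- **UNCONDITIONAL CEILING AT EVERY LARGE GAUGE**: a Hölder law valid for all steady passive
swirl pairs has `γ(N) ≤ 8/(N - 16)` for every `N ≥ 20` (choose `j = ⌊(N-20)/8⌋`: then
`N_j < 8j + 20 ≤ N < 8j + 28`). -/
theorem linearHolderLaw_exponent_le_eight_div {γ : ℝ → ℝ} (hlaw : LinearHolderLaw γ) {N : ℝ}
    (hN : 20 ≤ N) : γ N ≤ 8 / (N - 16) := by
  set j : ℕ := ⌊(N - 20) / 8⌋₊ with hj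
  have hx0 : 0 ≤ (N - 20) / 8 := by linarith
  have hjle : (j : ℝ) ≤ (N - 20) / 8 := Nat.floor_le hx0
  have hjlt : (N - 20) / 8 < j + 1 := Nat.lt_floor_add_one _
  have hj0 : (0 : ℝ) ≤ j := Nat.cast_nonneg j
  have hNj : 4 * ((2 * (j:ℝ) + 2) * (2 * j + 5) / (2 * j + 3)) ≤ N := by
    have key : (2 * (j:ℝ) + 2) * (2 * j + 5) / (2 * j + 3) ≤ 2 * j + 5 := by
      rw [div_le_iff₀ (by linarith)]; nlinarith
    linarith
  have h := linearHolderLaw_exponent_le_of_ge hlaw j hNj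
  refine h.trans ?_
  rw [div_le_div_iff₀ (by linarith) (by linarith)]
  linarith


/-- **The borderline `p = 1`**: the law `c(1+N)^{-1}` also fails for every `c > 8`
(`γ(N) ≤ 8/(N-16)` is eventually below `c/(1+N)` iff `c > 8`). -/
theorem not_linearHolderLaw_inv_of_gt_eight {c : ℝ} (hc : 8 < c) :
    ¬ LinearHolderLaw (fun N => c * (1 + N) ^ (-1 : ℝ)) := by
  intro hlaw
  have hc8 : 0 < c - 8 := by linarith
  -- at `N = 17c/(c-8) + 20 ≥ 20`: `(c-8)N = 37c - 160 > 16c + 8`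
  set N : ℝ := 17 * c / (c - 8) + 20 with hN
  have hN20 : (20 : ℝ) ≤ N := by
    have : 0 ≤ 17 * c / (c - 8) := by positivity
    linarith
  have hkey : (c - 8) * N = 17 * c + 20 * (c - 8) := by
    rw [hN]; field_simp
  have h := linearHolderLaw_exponent_le_eight_div hlaw hN20
  rw [Real.rpow_neg_one, ← div_eq_mul_inv, div_le_div_iff₀ (by linarith) (by linarith)] at h
  nlinarith [hkey]

end

end Summit.NavierStokesRegularity.NavierStokesRegularity.Theorems.SwirlHolderTower
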